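import Summits.Ventures.HodgeRepro2.T5BergmanIntegrableSharpU11

/-!
# The matrix coefficients of `π_k` vanish at infinity (`C₀`)

`|a(g)| → ∞` along the cocompact filter of `SU(1,1)` (`tendsto_norm_mat_cocompact`): the set
`{g : |a(g)| ≤ R}` is compact, being closed and contained in the preimage, under the closed embedding
`g ↦ mat g` of `SU(1,1)` into `M₂(ℂ)`, of the box `{A : |A_{ij}| ≤ R}` — for `g = su11 a b` the
entries are `a, b, b̄, ā` with `|b| ≤ |a|`. With the decay `|⟨π_k(g) S_N, T_M⟩_k| ≤ C |a(g)|^{-k}` of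
`T5BergmanIntegrableKFinite`, every `K`-finite matrix coefficient of `π_k` (`k ≥ 2`) tends to `0` along
the cocompact filter (`tendsto_matrixCoeff_partialSum_partialSum_cocompact`), and the uniform
approximation of a general coefficient by `K`-finite ones (`norm_matrixCoeff_sub_partialSum_*_le`
of `T5BergmanMatrixCoeff`, the Taylor tails `‖f - S_N‖_k → 0`) extends this to EVERY pair of
holomorphic `f, h ∈ A_k` (`tendsto_matrixCoeff_cocompact`): `π_k` is a `C₀`-representation — all its
matrix coefficients vanish at infinity. On `H_j = U(1,1)` the same holds
(`tendsto_matrixCoeffU_cocompact`): `mulHom : Circle × SU(1,1) → U(1,1)` is continuous and surjective,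
so `cocompact U(1,1) ≤ map mulHom (cocompact (Circle × SU(1,1)))`, and
`|⟨π_k(λ g) f, h⟩_k| = |⟨π_k(g) f, h⟩_k|`. Nothing is claimed about (N).

Blind lane: Mathlib + the HodgeRepro2 prefix only; no sorry; axioms ⊆ {propext, Classical.choice,
Quot.sound}.
-/

namespace Summit.Ventures.HodgeRepro2.T5BergmanCoefficientVanish

open MeasureTheory Metric Filter Topology Set
open T5PoincareDensity T5PoincareMeasure T5SU11Unimodular T5U11Unimodular T5U11Product
  T5SU11Fibration
open T5BergmanCoefficient T5BergmanPairing T5BergmanFourier T5BergmanParseval T5BergmanProjection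
  T5BergmanActStable T5BergmanMatrixCoeff T5BergmanKTypeMatrix T5BergmanIntegrableCoeff
  T5BergmanIntegrableSharp T5BergmanU11 T5BergmanSchurGeneralU11 T5BergmanIntegrableKFinite
open scoped Real

/-! ### `|a(g)| → ∞` along the cocompact filter of `SU(1,1)` -/

/-- `g ↦ mat g` is a closed embedding `SU(1,1) → M₂(ℂ)` (`SU(1,1)` is closed in `SL₂(ℂ)`, which is
closed in `M₂(ℂ)`). -/
theorem isClosedEmbedding_mat : Topology.IsClosedEmbedding (fun g : SU11 => mat g) :=
  Matrix.SpecialLinearGroup.isClosedEmbedding_val.comp isClosed_SU11.isClosedEmbedding_subtypeVal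

/-- `g ↦ mat g` is continuous. -/
theorem continuous_mat : Continuous (fun g : SU11 => mat g) :=
  isClosedEmbedding_mat.continuous

/-- `g ↦ a(g) = mat g 0 0` is continuous. -/
theorem continuous_mat_apply (i j : Fin 2) : Continuous (fun g : SU11 => mat g i j) :=
  (continuous_apply j).comp ((continuous_apply i).comp continuous_mat)

/-- `mat g 1 0 = conj (mat g 0 1)` for `g ∈ SU(1,1)`. -/
lemma mat_one_zero (g : SU11) : mat g 1 0 = (starRingEnd ℂ) (mat g 0 1) := by
  rw [show mat g 1 0 = su11 (mat g 0 0) (mat g 0 1) 1 0 from congrFun (congrFun (coe_eq_su11 g) 1) 0]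
  simp [su11]

/-- `mat g 1 1 = conj (mat g 0 0)` for `g ∈ SU(1,1)`. -/
lemma mat_one_one (g : SU11) : mat g 1 1 = (starRingEnd ℂ) (mat g 0 0) := by
  rw [show mat g 1 1 = su11 (mat g 0 0) (mat g 0 1) 1 1 from congrFun (congrFun (coe_eq_su11 g) 1) 1]
  simp [su11]

/-- `|b| ≤ |a|` for `g = su11 a b ∈ SU(1,1)` (`|a|² - |b|² = 1`). -/
lemma norm_mat_zero_one_le (g : SU11) : ‖mat g 0 1‖ ≤ ‖mat g 0 0‖ := by
  have h := normSq_sub_normSq g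
  rw [Complex.normSq_eq_norm_sq, Complex.normSq_eq_norm_sq] at h
  nlinarith [norm_nonneg (mat g 0 0), norm_nonneg (mat g 0 1)]

/-- **`{g ∈ SU(1,1) : |a(g)| ≤ R}` is compact**: it is closed and lies in the preimage of the compact
box `{A ∈ M₂(ℂ) : |A_{ij}| ≤ R}` under the closed embedding `g ↦ mat g`. -/
theorem isCompact_norm_mat_le (R : ℝ) : IsCompact {g : SU11 | ‖mat g 0 0‖ ≤ R} := by
  have hK : IsCompact (univ.pi fun _ : Fin 2 => univ.pi fun _ : Fin 2 => closedBall (0 : ℂ) R) :=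
    isCompact_univ_pi fun _ => isCompact_univ_pi fun _ => isCompact_closedBall 0 R
  refine (isClosedEmbedding_mat.isCompact_preimage hK).of_isClosed_subset
    (isClosed_le (continuous_norm.comp (continuous_mat_apply 0 0)) continuous_const) ?_
  intro g hg
  simp only [mem_setOf_eq] at hg
  have key : ∀ i j : Fin 2, ‖mat g i j‖ ≤ R := by
    simp only [Fin.forall_fin_two, mat_one_zero, mat_one_one, Complex.norm_conj]
    exact ⟨⟨hg, (norm_mat_zero_one_le g).trans hg⟩, (norm_mat_zero_one_le g).trans hg, hg⟩
  exact Set.mem_univ_pi.2 fun i => Set.mem_univ_pi.2 fun j => by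
    rw [mem_closedBall, dist_zero_right]
    exact key i j

/-- **`|a(g)| → ∞` along the cocompact filter of `SU(1,1)`**: outside the compact set
`{|a(g)| ≤ R}`, `|a(g)| > R`. -/
theorem tendsto_norm_mat_cocompact :
    Tendsto (fun g : SU11 => ‖mat g 0 0‖) (cocompact SU11) atTop := by
  rw [Filter.tendsto_atTop]
  intro R
  rw [Filter.eventually_iff, Filter.mem_cocompact]
  refine ⟨{g : SU11 | ‖mat g 0 0‖ ≤ R}, isCompact_norm_mat_le R, fun g hg => ?_⟩
  simp only [mem_compl_iff, mem_setOf_eq, not_le] at hg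
  exact hg.le

/-- `|a(g)|⁻¹ → 0` along the cocompact filter. -/
theorem tendsto_norm_mat_inv_cocompact :
    Tendsto (fun g : SU11 => ‖mat g 0 0‖⁻¹) (cocompact SU11) (𝓝 0) :=
  tendsto_inv_atTop_zero.comp tendsto_norm_mat_cocompact

/-- `|a(g)|^{-k} → 0` along the cocompact filter for `k ≥ 1`. -/
theorem tendsto_norm_mat_inv_pow_cocompact (k : ℕ) (hk : 1 ≤ k) :
    Tendsto (fun g : SU11 => ‖mat g 0 0‖⁻¹ ^ k) (cocompact SU11) (𝓝 0) := by
  have h := tendsto_norm_mat_inv_cocompact.pow k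
  rwa [zero_pow (by omega)] at h

/-! ### The `K`-finite coefficients vanish at infinity -/

/-- `⟨π_k(g) zᵐ, zⁿ⟩_k → 0` along the cocompact filter (`k ≥ 2`). -/
theorem tendsto_matrixCoeff_monomial_monomial_cocompact (k : ℕ) (hk : 2 ≤ k) (m n : ℕ) :
    Tendsto (matrixCoeff k (fun z => z ^ m) (fun z => z ^ n)) (cocompact SU11) (𝓝 0) := by
  refine squeeze_zero_norm (fun g => norm_matrixCoeff_monomial_monomial_le k hk g m n) ?_
  have h := (tendsto_norm_mat_inv_pow_cocompact k (by omega)).const_mul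
    (decayConst k m n * monomialNormSq k n)
  rwa [mul_zero] at h

/-- **Every `K`-finite matrix coefficient of `π_k` vanishes at infinity** (`k ≥ 2`): for polynomials
`S_N, T_M`, `⟨π_k(g) S_N, T_M⟩_k → 0` along the cocompact filter of `SU(1,1)`. -/
theorem tendsto_matrixCoeff_partialSum_partialSum_cocompact (k : ℕ) (hk : 2 ≤ k) (a b : ℕ → ℂ)
    (N M : ℕ) :
    Tendsto (matrixCoeff k (partialSum a N) (partialSum b M)) (cocompact SU11) (𝓝 0) := by
  refine squeeze_zero_norm (fun g => norm_matrixCoeff_partialSum_partialSum_le k hk a b N M g) ?_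
  have h := (tendsto_norm_mat_inv_pow_cocompact k (by omega)).const_mul (polyDecayConst k a b N M)
  rwa [mul_zero] at h

/-- The lowest-weight coefficient `⟨π_k(g) 1, 1⟩_k = (π/(k-1)) a(g)^{-k}` (in modulus) vanishes at
infinity. -/
theorem tendsto_matrixCoeff_lowest_lowest_cocompact (k : ℕ) (hk : 2 ≤ k) :
    Tendsto (matrixCoeff k lowest lowest) (cocompact SU11) (𝓝 0) := by
  refine squeeze_zero_norm (fun g => (norm_matrixCoeff_lowest_lowest k hk g).le) ?_
  have h := (tendsto_norm_mat_inv_pow_cocompact k (by omega)).const_mul (π / ((k : ℝ) - 1))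
  rwa [mul_zero] at h

/-! ### Uniform limits -/

/-- **A uniform limit of functions vanishing along a filter vanishes along it**: if
`sup_g |c g - F N g| ≤ e N` with `e N → 0`, and `F N → 0` along `l` for every `N`, then `c → 0`
along `l`. -/
lemma tendsto_zero_of_uniform_approx {α : Type*} {F : ℕ → α → ℂ} {c : α → ℂ} {e : ℕ → ℝ}
    {l : Filter α} (hF : ∀ N, Tendsto (F N) l (𝓝 0)) (he : Tendsto e atTop (𝓝 0))
    (hb : ∀ N g, ‖c g - F N g‖ ≤ e N) : Tendsto c l (𝓝 0) := by
  rw [Metric.tendsto_nhds]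
  intro ε hε
  obtain ⟨N, hN⟩ := (Metric.tendsto_atTop.1 he) (ε / 2) (half_pos hε)
  have hN' : e N < ε / 2 := by
    have := hN N le_rfl
    rw [Real.dist_eq, sub_zero] at this
    exact (abs_lt.1 this).2
  filter_upwards [Metric.tendsto_nhds.1 (hF N) (ε / 2) (half_pos hε)] with g hg
  rw [dist_zero_right] at hg ⊢
  calc ‖c g‖ = ‖(c g - F N g) + F N g‖ := by rw [sub_add_cancel]
    _ ≤ ‖c g - F N g‖ + ‖F N g‖ := norm_add_le _ _
    _ < ε / 2 + ε / 2 := add_lt_add_of_le_of_lt ((hb N g).trans hN'.le) hg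
    _ = ε := add_halves ε

/-! ### Every matrix coefficient vanishes at infinity -/

/-- `⟨π_k(g) S_N, h⟩_k → 0` along the cocompact filter for a polynomial `S_N` and `h ∈ A_k` with
Taylor coefficients `b`. -/
theorem tendsto_matrixCoeff_partialSum_cocompact (k : ℕ) (hk : 2 ≤ k) (a : ℕ → ℂ) (N : ℕ)
    (b : ℕ → ℂ) (h : ℂ → ℂ) (hh : ∀ w ∈ ball (0 : ℂ) 1, HasSum (fun m => b m * w ^ m) (h w))
    (hhint : IntegrableOn (fun w => ‖h w‖ ^ 2 * (1 - ‖w‖ ^ 2) ^ (k - 2)) (ball (0 : ℂ) 1)) :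
    Tendsto (matrixCoeff k (partialSum a N) h) (cocompact SU11) (𝓝 0) := by
  have hS : DifferentiableOn ℂ (partialSum a N) (ball 0 1) :=
    (differentiable_partialSum a N).differentiableOn
  refine tendsto_zero_of_uniform_approx
    (F := fun M => matrixCoeff k (partialSum a N) (partialSum b M))
    (e := fun M => Real.sqrt ((pairing k (partialSum a N) (partialSum a N)).re *
      (pairing k (h - partialSum b M) (h - partialSum b M)).re))
    (fun M => tendsto_matrixCoeff_partialSum_partialSum_cocompact k hk a b N M) ?_ (fun M g => ?_)
  · have h1 := (tendsto_pairing_sub_partialSum k hk b h hh hhint).const_mul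
      (pairing k (partialSum a N) (partialSum a N)).re
    rw [mul_zero] at h1
    have h2 := h1.sqrt
    rwa [Real.sqrt_zero] at h2
  · exact norm_matrixCoeff_sub_partialSum_right_le k hk _ hS (integrableOn_partialSum k a N) b h hh
      hhint M g

/-- **`π_k` is a `C₀`-representation**: for holomorphic `f, h ∈ A_k` with Taylor coefficients `a, b`
(`k ≥ 2`), `⟨π_k(g) f, h⟩_k → 0` along the cocompact filter of `SU(1,1)`. -/
theorem tendsto_matrixCoeff_cocompact (k : ℕ) (hk : 2 ≤ k) (a : ℕ → ℂ) (f : ℂ → ℂ)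
    (hf : DifferentiableOn ℂ f (ball 0 1))
    (hfa : ∀ w ∈ ball (0 : ℂ) 1, HasSum (fun m => a m * w ^ m) (f w))
    (hfint : IntegrableOn (fun w => ‖f w‖ ^ 2 * (1 - ‖w‖ ^ 2) ^ (k - 2)) (ball (0 : ℂ) 1))
    (b : ℕ → ℂ) (h : ℂ → ℂ) (hh : ∀ w ∈ ball (0 : ℂ) 1, HasSum (fun m => b m * w ^ m) (h w))
    (hhint : IntegrableOn (fun w => ‖h w‖ ^ 2 * (1 - ‖w‖ ^ 2) ^ (k - 2)) (ball (0 : ℂ) 1)) :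
    Tendsto (matrixCoeff k f h) (cocompact SU11) (𝓝 0) := by
  have hhc : ContinuousOn h (ball 0 1) := continuousOn_ball b h hh
  refine tendsto_zero_of_uniform_approx (F := fun N => matrixCoeff k (partialSum a N) h)
    (e := fun N => Real.sqrt ((pairing k (f - partialSum a N) (f - partialSum a N)).re *
      (pairing k h h).re))
    (fun N => tendsto_matrixCoeff_partialSum_cocompact k hk a N b h hh hhint) ?_
    (fun N g => norm_matrixCoeff_sub_partialSum_left_le k hk a f hf hfa hfint h hhc hhint N g)
  have h1 := (tendsto_pairing_sub_partialSum k hk a f hfa hfint).mul_const (pairing k h h).re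
  rw [zero_mul] at h1
  have h2 := h1.sqrt
  rwa [Real.sqrt_zero] at h2

/-- **Every matrix coefficient of `π_k` vanishes at infinity** (`k ≥ 2`, holomorphic `f, h ∈ A_k`). -/
theorem tendsto_matrixCoeff_cocompact_of_differentiableOn (k : ℕ) (hk : 2 ≤ k) (f : ℂ → ℂ)
    (hf : DifferentiableOn ℂ f (ball 0 1))
    (hfint : IntegrableOn (fun w => ‖f w‖ ^ 2 * (1 - ‖w‖ ^ 2) ^ (k - 2)) (ball (0 : ℂ) 1))
    (h : ℂ → ℂ) (hh : DifferentiableOn ℂ h (ball 0 1))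
    (hhint : IntegrableOn (fun w => ‖h w‖ ^ 2 * (1 - ‖w‖ ^ 2) ^ (k - 2)) (ball (0 : ℂ) 1)) :
    Tendsto (matrixCoeff k f h) (cocompact SU11) (𝓝 0) :=
  tendsto_matrixCoeff_cocompact k hk _ f hf (hasSum_taylor f hf) hfint _ h (hasSum_taylor h hh) hhint

/-! ### On `H_j = U(1,1)` -/

/-- `Prod.snd : Circle × SU(1,1) → SU(1,1)` carries the cocompact filter to the cocompact filter
(`Circle` is compact). -/
lemma tendsto_snd_cocompact :
    Tendsto (Prod.snd : Circle × SU11 → SU11) (cocompact (Circle × SU11)) (cocompact SU11) := by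
  rw [Filter.hasBasis_cocompact.tendsto_right_iff]
  intro K hK
  rw [Filter.eventually_iff, Filter.mem_cocompact]
  refine ⟨univ ×ˢ K, isCompact_univ.prod hK, fun p hp => ?_⟩
  simp only [mem_compl_iff, mem_prod, mem_univ, true_and] at hp
  exact hp

/-- `cocompact U(1,1) ≤ map mulHom (cocompact (Circle × SU(1,1)))`: `mulHom` is continuous and
surjective, so the image of a compact set is compact and every point outside it comes from outside
the set. -/
lemma cocompact_le_map_mulHom : cocompact U11 ≤ map mulHom (cocompact (Circle × SU11)) := by
  intro s hs
  rw [mem_map, Filter.mem_cocompact] at hs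
  obtain ⟨L, hL, hLs⟩ := hs
  rw [Filter.mem_cocompact]
  refine ⟨mulHom '' L, hL.image continuous_mulHom, fun u hu => ?_⟩
  obtain ⟨p, rfl⟩ := mulHom_surjective u
  have hp : p ∉ L := fun hp => hu ⟨p, hp, rfl⟩
  exact hLs hp

/-- **Every matrix coefficient of `π_k` on `H_j = U(1,1)` vanishes at infinity** (`k ≥ 2`, holomorphic
`f, h ∈ A_k`): `⟨π_k(g) f, h⟩_k → 0` along the cocompact filter of `U(1,1)`. -/
theorem tendsto_matrixCoeffU_cocompact (k : ℕ) (hk : 2 ≤ k) (f : ℂ → ℂ)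
    (hf : DifferentiableOn ℂ f (ball 0 1))
    (hfint : IntegrableOn (fun w => ‖f w‖ ^ 2 * (1 - ‖w‖ ^ 2) ^ (k - 2)) (ball (0 : ℂ) 1))
    (h : ℂ → ℂ) (hh : DifferentiableOn ℂ h (ball 0 1))
    (hhint : IntegrableOn (fun w => ‖h w‖ ^ 2 * (1 - ‖w‖ ^ 2) ^ (k - 2)) (ball (0 : ℂ) 1)) :
    Tendsto (matrixCoeffU k f h) (cocompact U11) (𝓝 0) := by
  have hS := tendsto_matrixCoeff_cocompact_of_differentiableOn k hk f hf hfint h hh hhint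
  have h1 : Tendsto (matrixCoeffU k f h ∘ mulHom) (cocompact (Circle × SU11)) (𝓝 0) := by
    refine squeeze_zero_norm (fun p => ?_)
      (tendsto_zero_iff_norm_tendsto_zero.1 (hS.comp tendsto_snd_cocompact))
    obtain ⟨lam, g⟩ := p
    exact (norm_matrixCoeffU_mulHom' k f h lam g).le
  exact (Filter.tendsto_map'_iff.2 h1).mono_left cocompact_le_map_mulHom

/-- Every `K`-finite matrix coefficient of `π_k` on `U(1,1)` vanishes at infinity. -/
theorem tendsto_matrixCoeffU_partialSum_partialSum_cocompact (k : ℕ) (hk : 2 ≤ k) (a b : ℕ → ℂ)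
    (N M : ℕ) :
    Tendsto (matrixCoeffU k (partialSum a N) (partialSum b M)) (cocompact U11) (𝓝 0) :=
  tendsto_matrixCoeffU_cocompact k hk _ (differentiable_partialSum a N).differentiableOn
    (integrableOn_partialSum k a N) _ (differentiable_partialSum b M).differentiableOn
    (integrableOn_partialSum k b M)

end Summit.Ventures.HodgeRepro2.T5BergmanCoefficientVanish
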